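import Literature.NumberTheory.LFunctions.Zhang2022.KnifeEdgeGramPSD

/-!
# Zhang (2022), rung F-S3 (Landau–Siegel programme, §D/§E typing infrastructure): the GENERIC Gram endgame — entrywise
# main-term SLOTS for a finite family of value tables compose to the member's asymptotic, and a main-term matrix that is
# NOT positive semidefinite on some amplitude vector refutes (A) by positivity (PROVED; nothing asserted)

Y. Zhang, *Discrete mean estimates and the Landau–Siegel zero*, arXiv:2211.02515v1 [Zhang2022LandauSiegel] —
an unrefereed manuscript under adjudication. **WHAT THIS IS NOT: not a claim about Theorems 1–2 of
arXiv:2211.02515, about Landau–Siegel zeros, or about Parity. The programme SEARCHES and TYPES; no claim about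
Landau–Siegel zeros, Theorems 1–2 of arXiv:2211.02515 or a repaired Margin232 until a kernel theorem says so.
`GramEntryAsymp` is a slot SHAPE (a bare `Prop` with a named constant); every `theorem` is finite-sum bookkeeping
or an implication from such slots and the skeleton's CLAIMS `Prop22i`, `Lemma23`.**

WHY (typer's tool, cell landau-siegel §D; companion BY NAME of `KnifeEdgeGramPSD` — `tableComb`, `discPolar_tableComb`,
`discMean_tableComb`, `discGram_posSemidef` — and the abstract form of `KnifeEdgeLenZDegreeEndgame`): every multi-piece
design of the programme (two-piece `s·u ⊕ v`, wall/band/jump designs, `k`-block designs, the Z-degree graded design,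
its χ-FREE re-typing asked by the §D critic 2026-08-27T01:11Z) is a member `Σ_i x_i·H_i(D,χ)` of a finite family of
`D`-indexed value tables, and every card's «First lemma» is a list of ENTRY SLOTS «under (A), eventually,
`Ξ(H_a, H_b) = M_{ab}·𝔞𝔓 + o(𝔞𝔓)`» with NAMED constants `M_{ab}`. This file proves once and for all:
* `forAllLarge_fintype` — finitely many eventual statements hold eventually together;
* `GramEntryAsymp c' U V m` — the entry slot (shape, OPEN per instance);
* `discMean_tableComb_asymp` — the slots for all `(a,b)` give `|Ξ(Σ x_i H_i) − Re(x†Mx)·𝔞𝔓| ≤ ε𝔞𝔓` eventually under (A)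
  (error `(Σ|x_a|)²·δ`);
* `eventually_not_assumptionA_of_gramSlots` / **`theorem1_of_gramSlots`** / `theorem2_of_gramSlots` — if moreover
  `Re(x†Mx) < 0` for some amplitude vector `x` (the main-term matrix is not PSD in that direction), then with Prop. 2.2 (i)
  and Lemma 2.3 (every discrete mean `≥ 0`, `discMean_nonneg`; `𝔞 ≥ a₀ > 0`, `𝔓 > 0`) (A) fails to every large modulus,
  hence Theorem 1 (Theorem 2). No `θ`, no margin, any index type, any tables.

## References
* Y. Zhang, arXiv:2211.02515v1 (2022), §1 Theorems 1–2; §2 p. 6, (2.15)–(2.17), Lemma 2.3, Prop. 2.2 (i).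
  [cite: Zhang2022LandauSiegel, §1, §2 (2.16)–(2.17), Lemma 2.3, Prop. 2.2 (i)]
-/

noncomputable section

open Complex Real ComplexConjugate

namespace Literature.NumberTheory.LFunctions.Zhang2022.KnifeEdge

open Repair Skeleton

/-! ### Part 1 — finitely many eventual statements; the entry slot -/

/-- Finitely many `ForAllLarge` statements hold eventually together (take the largest threshold).
[cite: Zhang2022LandauSiegel, §2 p. 4] -/
theorem forAllLarge_fintype {ι : Type*} [Fintype ι] {S : ι → (D : ℕ) → [NeZero D] → DirichletCharacter ℂ D → Prop}
    (h : ∀ i, ForAllLarge (S i)) : ForAllLarge fun D _ χ => ∀ i, S i D χ := by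
  classical
  choose D₀ hD₀ using h
  refine ⟨Finset.univ.sup D₀, fun D _ χ hD hq hp i => hD₀ i D χ (le_trans (Finset.le_sup (Finset.mem_univ i)) hD) hq hp⟩

/-- A `D`-indexed family of value tables `(ψ, ρ) ↦ H(D, χ; ψ, ρ)` (a piece of a design: profile polynomial, band block,
graded vector, …). [cite: Zhang2022LandauSiegel, §2 (2.16)] -/
abbrev DTable : Type := (D : ℕ) → [NeZero D] → DirichletCharacter ℂ D → Chr D → ℂ → ℂ

variable (c' : ℝ)

/-- **ENTRY SLOT (shape, OPEN per instance — asserted by no one):** under (A), eventually in `D`, the polar pairing of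
the two tables is `m·𝔞𝔓 + o(𝔞𝔓)` with a NAMED constant `m` (a card's side table / cross table / overhang block …).
[cite: Zhang2022LandauSiegel, §2 (2.16)–(2.17), §7 Prop 7.1, §8 (8.3)–(8.5)] -/
def GramEntryAsymp (U V : DTable) (m : ℂ) : Prop :=
  ∀ ε : ℝ, 0 < ε → ForAllLarge fun D _ χ => AssumptionA D χ →
    ‖discPolar c' χ (U D χ) (V D χ) - m * frakA χ * frakP D‖ ≤ ε * frakA χ * frakP D

variable {c'}

/-- The slot is Hermitian-symmetric: `Ξ(V,U) ≈ conj m` from `Ξ(U,V) ≈ m`. [cite: Zhang2022LandauSiegel, §2 (2.17)] -/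
theorem GramEntryAsymp.symm {U V : DTable} {m : ℂ} (h : GramEntryAsymp c' U V m) :
    GramEntryAsymp c' V U (conj m) := by
  intro ε hε
  refine (h ε hε).mono fun D _ χ _ _ h1 hA => ?_
  rw [← discPolar_conj_symm, ← Complex.conj_ofReal (frakA χ), ← Complex.conj_ofReal (frakP D), ← map_mul, ← map_mul,
    ← map_sub, Complex.norm_conj]
  exact h1 hA

/-! ### Part 2 — the slots compose to the member's asymptotic -/

/-- error bookkeeping for a Gram form: entrywise errors `≤ δ·A` give `≤ (Σ|x_a|)²·δ·A` (pure algebra). [folklore] -/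
private theorem quadForm_error' {ι : Type*} [Fintype ι] (x : ι → ℂ) (E M : ι → ι → ℂ) {δ A : ℝ}
    (h : ∀ a b, ‖E a b - M a b * A‖ ≤ δ * A) :
    ‖(∑ a, ∑ b, x a * conj (x b) * E a b) - (∑ a, ∑ b, x a * conj (x b) * M a b) * A‖
      ≤ (∑ a, ‖x a‖) ^ 2 * (δ * A) := by
  have hre : (∑ a, ∑ b, x a * conj (x b) * E a b) - (∑ a, ∑ b, x a * conj (x b) * M a b) * A
      = ∑ a, ∑ b, x a * conj (x b) * (E a b - M a b * A) := by
    rw [Finset.sum_mul, ← Finset.sum_sub_distrib]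
    refine Finset.sum_congr rfl fun a _ => ?_
    rw [Finset.sum_mul, ← Finset.sum_sub_distrib]
    refine Finset.sum_congr rfl fun b _ => ?_
    ring
  rw [hre]
  calc ‖∑ a, ∑ b, x a * conj (x b) * (E a b - M a b * A)‖
      ≤ ∑ a, ∑ b, ‖x a‖ * ‖x b‖ * (δ * A) := by
        refine (norm_sum_le _ _).trans (Finset.sum_le_sum fun a _ => (norm_sum_le _ _).trans
          (Finset.sum_le_sum fun b _ => ?_))
        rw [norm_mul, norm_mul, Complex.norm_conj]
        exact mul_le_mul_of_nonneg_left (h a b) (by positivity)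
    _ = (∑ a, ‖x a‖) ^ 2 * (δ * A) := by
        rw [sq, Finset.sum_mul_sum, Finset.sum_mul]
        refine Finset.sum_congr rfl fun a _ => ?_
        rw [Finset.sum_mul]

/-- **THE SLOTS COMPOSE (proved):** entry slots for every pair `(a,b)` of a finite family of tables `U` with constants
`M_{ab}` give, for every amplitude vector `x` and `ε > 0`, eventually under (A),
`|Ξ(Σ_i x_i U_i) − Re(Σ_{a,b} x_a conj(x_b) M_{ab})·𝔞𝔓| ≤ ε𝔞𝔓`. [cite: Zhang2022LandauSiegel, §2 (2.16)–(2.17)] -/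
theorem discMean_tableComb_asymp {ι : Type*} [Fintype ι] {U : ι → DTable} {M : ι → ι → ℂ}
    (h : ∀ a b, GramEntryAsymp c' (U a) (U b) (M a b)) (x : ι → ℂ) {ε : ℝ} (hε : 0 < ε) :
    ForAllLarge fun D _ χ => AssumptionA D χ →
      |discMean c' χ (tableComb x fun i => U i D χ) - (∑ a, ∑ b, x a * conj (x b) * M a b).re * frakA χ * frakP D|
        ≤ ε * frakA χ * frakP D := by
  set K : ℝ := (∑ a, ‖x a‖) ^ 2 + 1 with hK
  have hK0 : 0 < K := by positivity
  have hδ : 0 < ε / K := div_pos hε hK0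
  refine (forAllLarge_fintype (ι := ι × ι) fun ab => h ab.1 ab.2 (ε / K) hδ).mono fun D _ χ _ _ hall hA => ?_
  set A : ℝ := frakA χ * frakP D with hA_def
  have hAP : 0 ≤ A := mul_nonneg (frakA_nonneg χ) (frakP_nonneg D)
  have hall' : ∀ a b, ‖discPolar c' χ (U a D χ) (U b D χ) - M a b * (A : ℂ)‖ ≤ ε / K * A := by
    intro a b
    have h1 := hall (a, b) hA
    rw [mul_assoc, mul_assoc, ← Complex.ofReal_mul, ← hA_def] at h1
    exact h1
  have hsum := quadForm_error' x (fun a b => discPolar c' χ (U a D χ) (U b D χ)) M hall'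
  have hmean := discMean_tableComb (c' := c') (χ := χ) x fun i => U i D χ
  have key : |discMean c' χ (tableComb x fun i => U i D χ) - (∑ a, ∑ b, x a * conj (x b) * M a b).re * A|
      ≤ (∑ a, ‖x a‖) ^ 2 * (ε / K * A) := by
    have h1 : discMean c' χ (tableComb x fun i => U i D χ) - (∑ a, ∑ b, x a * conj (x b) * M a b).re * A =
        ((∑ a, ∑ b, x a * conj (x b) * discPolar c' χ (U a D χ) (U b D χ))
          - (∑ a, ∑ b, x a * conj (x b) * M a b) * (A : ℂ)).re := by
      rw [Complex.sub_re, ← hmean, Complex.ofReal_re, Complex.mul_re, Complex.ofReal_re, Complex.ofReal_im,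
        mul_zero, sub_zero]
    rw [h1]
    exact (Complex.abs_re_le_norm _).trans hsum
  have hfrac : (∑ a, ‖x a‖) ^ 2 * (ε / K) ≤ ε := by
    rw [← mul_div_assoc, div_le_iff₀ hK0, hK]
    nlinarith [sq_nonneg (∑ a, ‖x a‖)]
  have hfin : |discMean c' χ (tableComb x fun i => U i D χ) - (∑ a, ∑ b, x a * conj (x b) * M a b).re * A|
      ≤ ε * A := key.trans (by nlinarith [mul_le_mul_of_nonneg_right hfrac hAP])
  simpa [hA_def, mul_assoc] using hfin

/-! ### Part 3 — the positivity endgame for a non-PSD main-term matrix -/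

/-- **THE POSITIVITY ENDGAME FOR ANY VALUE TABLES (proved):** if under (A) the discrete mean of SOME tables `F_D`
has the UPPER asymptotic `Ξ(F_D) ≤ (m + ε)·𝔞𝔓` with `m < 0`, then — Prop. 2.2 (i) and Lemma 2.3 making every discrete
mean `≥ 0` (`discMean_nonneg`) — (A) fails to every large modulus (`𝔞 ≥ a₀ > 0`, `𝔓 > 0`).
[cite: Zhang2022LandauSiegel, §2 p. 6, Lemma 2.3, Prop. 2.2 (i), (2.15)] -/
theorem eventually_not_assumptionA_of_upper_const {m : ℝ} (hm : m < 0) {F : DTable}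
    (hasymp : ∀ ε : ℝ, 0 < ε → ForAllLarge fun D _ χ => AssumptionA D χ →
      discMean c' χ (F D χ) - m * frakA χ * frakP D ≤ ε * frakA χ * frakP D)
    (h22 : Prop22i) (h23 : Lemma23 c') :
    ∃ D₀ : ℕ, ∀ (D : ℕ) [NeZero D] (χ : DirichletCharacter ℂ D),
      D₀ ≤ D → χ.IsQuadratic → χ.IsPrimitive → ¬ AssumptionA D χ := by
  have hε : 0 < -m / 2 := by linarith
  obtain ⟨a₀, ha₀, hA⟩ := frakALowerBound_holds
  obtain ⟨D₃, h₃⟩ := frakP_eventually_pos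
  obtain ⟨D₁, h₁⟩ := (((hasymp (-m / 2) hε).and h22).and h23).and hA
  refine ⟨max (max D₁ D₃) 3, fun D _ χ hD hq hp hAss => ?_⟩
  have hD₁ : D₁ ≤ D := le_trans (le_trans (le_max_left _ _) (le_max_left _ _)) hD
  have hD₃ : D₃ ≤ D := le_trans (le_trans (le_max_right _ _) (le_max_left _ _)) hD
  have hD3 : 3 ≤ D := le_trans (le_max_right _ _) hD
  obtain ⟨⟨⟨hmean, h22'⟩, h23'⟩, hA'⟩ := h₁ D χ hD₁ hq hp
  have hup := hmean hAss
  have hA0 : 0 < frakA χ := lt_of_lt_of_le ha₀ (hA' hAss)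
  have hP0 : 0 < frakP D := h₃ D hD₃
  have hpos := discMean_nonneg (weights_nonneg_of hD3 h23' h22') (F D χ)
  have hX : 0 < frakA χ * frakP D := mul_pos hA0 hP0
  nlinarith

/-- **THE GENERIC GRAM ENDGAME (proved): entry slots for a finite family of tables ∧ an amplitude vector on which the
main-term matrix has NEGATIVE real quadratic form ∧ Prop. 2.2 (i) ∧ Lemma 2.3 ⇒ (A) fails eventually.** Every
multi-piece positivity design of the programme is an instance (two-piece, wall/band, `k`-block, Z-degree graded, …).
[cite: Zhang2022LandauSiegel, §2 p. 6, (2.16)–(2.17), Lemma 2.3, Prop. 2.2 (i)] -/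
theorem eventually_not_assumptionA_of_gramSlots {ι : Type*} [Fintype ι] {U : ι → DTable} {M : ι → ι → ℂ}
    (h : ∀ a b, GramEntryAsymp c' (U a) (U b) (M a b)) {x : ι → ℂ}
    (hneg : (∑ a, ∑ b, x a * conj (x b) * M a b).re < 0) (h22 : Prop22i) (h23 : Lemma23 c') :
    ∃ D₀ : ℕ, ∀ (D : ℕ) [NeZero D] (χ : DirichletCharacter ℂ D),
      D₀ ≤ D → χ.IsQuadratic → χ.IsPrimitive → ¬ AssumptionA D χ :=
  eventually_not_assumptionA_of_upper_const (F := fun D _ χ => tableComb x fun i => U i D χ) hneg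
    (fun _ hε => (discMean_tableComb_asymp h x hε).mono fun _ _ _ _ _ h1 hA => (abs_le.mp (h1 hA)).2) h22 h23

/-- **… hence Theorem 1** (`L(1,χ) > c₁(log D)⁻²⁰²²`). Hypotheses OPEN / CLAIMS; nothing asserted.
[cite: Zhang2022LandauSiegel, §1 Theorem 1, §2 p. 6] -/
theorem theorem1_of_gramSlots {ι : Type*} [Fintype ι] {U : ι → DTable} {M : ι → ι → ℂ}
    (h : ∀ a b, GramEntryAsymp c' (U a) (U b) (M a b)) {x : ι → ℂ}
    (hneg : (∑ a, ∑ b, x a * conj (x b) * M a b).re < 0) (h22 : Prop22i) (h23 : Lemma23 c') : Theorem1 :=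
  Skeleton.theorem1_of_eventually_not_assumptionA (eventually_not_assumptionA_of_gramSlots h hneg h22 h23)

/-- … and Theorem 2. [cite: Zhang2022LandauSiegel, §1 Theorem 2] -/
theorem theorem2_of_gramSlots {ι : Type*} [Fintype ι] {U : ι → DTable} {M : ι → ι → ℂ}
    (h : ∀ a b, GramEntryAsymp c' (U a) (U b) (M a b)) {x : ι → ℂ}
    (hneg : (∑ a, ∑ b, x a * conj (x b) * M a b).re < 0) (h22 : Prop22i) (h23 : Lemma23 c') : Theorem2 :=
  Skeleton.theorem2_of_theorem1 (theorem1_of_gramSlots h hneg h22 h23)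

/-- **Lower-triangular bookkeeping:** for a Hermitian-symmetric constant matrix it suffices to give the slots for
`b ≤ a` (any linear order on the index type); the others follow by `GramEntryAsymp.symm`.
[cite: Zhang2022LandauSiegel, §2 (2.17)] -/
theorem gramEntryAsymp_of_lower {ι : Type*} [LinearOrder ι] {U : ι → DTable} {M : ι → ι → ℂ}
    (hM : ∀ a b, M b a = conj (M a b)) (h : ∀ a b, b ≤ a → GramEntryAsymp c' (U a) (U b) (M a b)) :
    ∀ a b, GramEntryAsymp c' (U a) (U b) (M a b) := by
  intro a b
  rcases le_total b a with hba | hab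
  · exact h a b hba
  · rw [show M a b = conj (M b a) from hM b a]
    exact (h b a hab).symm

end Literature.NumberTheory.LFunctions.Zhang2022.KnifeEdge

end
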